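import Summits.CriticalPhenomena.PercolationContinuityZ3.Theorems.PercNearOneGluingNoHeavyLowerTailAPLTreeFourPointAll
import HarnessLib

/-!
# `NoHeavyLowerTail` (stmt-CriticalPhenomena-4575) — (T3′) summed against loads: the cluster-load fluctuation inequality
# `3·Cov(L, S₂) ≤ 2·(E L³ − (E L)³)` on every finite weighted graph

Support file (prover prim-ineq-gen-8 gen 40; `--supports stmt-CriticalPhenomena-4575`; memo
run/shared/lean/prim/prim-ineq-gen-8/FINDING-gen40-T3.md §0(3)).  No definitions, no named facts, no sorries.

`μ = prodBernoulli w` on the pairs of a finite vertex type `V`; a root `a`; non-negative vertex loads `ℓ`;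
`L = Σ_u ℓ_u·1[a↔u]` (the load of the open cluster of `a`), `S₂ = Σ_{v,x} ℓ_v ℓ_x·1[v↔x]` (`= Σ_K ℓ(K)²` over the open clusters `K`).
Gen 39 (memo FINDING-gen39-TE-CORES.md §0(5)) proved `κ₃(L) + 3·Cov(L, S₂ − L²) ≤ 0`, i.e. `3·Cov(L,S₂) ≤ 2·(EL³ − (EL)³)` (unit loads:
`3·Cov(|C_a|, Σ_K |K|²) ≤ 2·(E|C_a|³ − (E|C_a|)³)`; summed over roots `Var(Σ_K|K|²) ≤ (2/3)(E Σ_K|K|⁴ − Σ_x (E|C_x|)³)`, sharp on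
near-critical Erdős–Rényi graphs) from APL-P read at third order through an idealised Poisson-cloud limit.  Here it is the sharp
four-point tree inequality (T3′) (`APL.treeFourPoint_all`) multiplied by `ℓ_u ℓ_v ℓ_x` and summed — a finite computation:
* `treeFourPoint_loads` — the LOAD FORM `Σ_{u,v,x} ℓ_uℓ_vℓ_x·[P(a↔u,a↔v,a↔x) + 3·P(a↔u,a↮v,v↔x) + 2·τ_uτ_vτ_x − 3·τ_u·P(v↔x)] ≤ 0`
  (`τ_y = P(a↔y)`; the two asymmetric families of (T3′) are re-indexed onto the first, `sum3_swap12`, `sum3_cycle`);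
* `integral_load`, `integral_S2`, `integral_load_mul_S2`, `integral_load_cube` — the moments of `L`, `S₂` as connection sums;
* **`cov_load_S2_le`** — `3·(E[L·S₂] − E[L]·E[S₂]) ≤ 2·(E[L³] − E[L]³)` for every finite weighted graph, root and loads `ℓ ≥ 0`.
[this work]
-/

noncomputable section

namespace Summit.CriticalPhenomena.PercolationContinuityZ3.Theorems

namespace APL

open MeasureTheory Set Literature.Probability.Percolation Literature.Probability.LatticeModels
open scoped Classical

variable {V : Type*}

/-! ### The load form: gen 39's third-order tip inequality (P) -/

section Loads

variable [Fintype V]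

/-- Reindexing `(u,v,x) ↦ (v,u,x)` of a weighted triple sum. [folklore] -/
theorem sum3_swap12 (ℓ : V → ℝ) (f : V → V → V → ℝ) :
    ∑ u, ∑ v, ∑ x, ℓ u * ℓ v * ℓ x * f v u x = ∑ u, ∑ v, ∑ x, ℓ u * ℓ v * ℓ x * f u v x := by
  rw [Finset.sum_comm]
  refine Finset.sum_congr rfl fun u _ => Finset.sum_congr rfl fun v _ => Finset.sum_congr rfl fun x _ => ?_
  ring

/-- Reindexing `(u,v,x) ↦ (x,u,v)` of a weighted triple sum. [folklore] -/
theorem sum3_cycle (ℓ : V → ℝ) (f : V → V → V → ℝ) :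
    ∑ u, ∑ v, ∑ x, ℓ u * ℓ v * ℓ x * f x u v = ∑ u, ∑ v, ∑ x, ℓ u * ℓ v * ℓ x * f u v x := by
  -- move the innermost binder outermost (two commutations), then rename
  have h1 : ∑ u, ∑ v, ∑ x, ℓ u * ℓ v * ℓ x * f x u v = ∑ u, ∑ x, ∑ v, ℓ u * ℓ v * ℓ x * f x u v :=
    Finset.sum_congr rfl fun u _ => Finset.sum_comm
  rw [h1, Finset.sum_comm]
  refine Finset.sum_congr rfl fun u _ => Finset.sum_congr rfl fun v _ => Finset.sum_congr rfl fun x _ => ?_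
  ring

/-- **The LOAD FORM of (T3′) = gen 39's (P) at the root `a`.**  For non-negative vertex loads `ℓ` (with `τ_y = P(a↔y)`):
`Σ_{u,v,x} ℓ_u ℓ_v ℓ_x · [P(a↔u,a↔v,a↔x) + 3·P(a↔u, a↮v, v↔x) + 2·τ_u τ_v τ_x − 3·τ_u·P(v↔x)] ≤ 0`.
With `L = Σ_u ℓ_u 1[a↔u]` (load of the cluster of `a`), `S₂ = Σ_{v,x} ℓ_v ℓ_x 1[v↔x] = Σ_K ℓ(K)²` this reads
`E L³ + 3·E[L·(S₂ − L²)] + 2(EL)³ − 3·EL·ES₂ ≤ 0`, i.e. `3·Cov(L, S₂) ≤ 2·(EL³ − (EL)³)`, i.e. `κ₃(L) + 3·Cov(L, S₂ − L²) ≤ 0`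
(gen 39 memo §0(5): there derived from APL-P through an idealised-cloud limit; here a finite identity-free consequence of (T3′)). [this work] -/
theorem treeFourPoint_loads (w : Sym2 V → unitInterval) (a : V) (ℓ : V → ℝ) (hℓ : ∀ y, 0 ≤ ℓ y) :
    ∑ u, ∑ v, ∑ x, ℓ u * ℓ v * ℓ x *
        ((prodBernoulli w).real (openConn a u ∩ openConn a v ∩ openConn a x : Set (BondConfig V))
          + 3 * (prodBernoulli w).real (openConn a u ∩ (openConn a v)ᶜ ∩ openConn v x : Set (BondConfig V))
          + 2 * (prodBernoulli w).real (openConn a u : Set (BondConfig V)) * (prodBernoulli w).real (openConn a v : Set (BondConfig V))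
              * (prodBernoulli w).real (openConn a x : Set (BondConfig V))
          - 3 * ((prodBernoulli w).real (openConn a u : Set (BondConfig V))
              * (prodBernoulli w).real (openConn v x : Set (BondConfig V)))) ≤ 0 := by
  -- the symmetric sum of the (T3′)-slacks is ≤ 0
  have hsym : ∑ u, ∑ v, ∑ x, ℓ u * ℓ v * ℓ x *
      ((prodBernoulli w).real (openConn a u ∩ openConn a v ∩ openConn a x : Set (BondConfig V))
        + (prodBernoulli w).real (openConn a u ∩ (openConn a v)ᶜ ∩ openConn v x : Set (BondConfig V))
        + (prodBernoulli w).real (openConn a v ∩ (openConn a u)ᶜ ∩ openConn u x : Set (BondConfig V))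
        + (prodBernoulli w).real (openConn a x ∩ (openConn a u)ᶜ ∩ openConn u v : Set (BondConfig V))
        + 2 * (prodBernoulli w).real (openConn a u : Set (BondConfig V)) * (prodBernoulli w).real (openConn a v : Set (BondConfig V))
          * (prodBernoulli w).real (openConn a x : Set (BondConfig V))
        - ((prodBernoulli w).real (openConn a u : Set (BondConfig V)) * (prodBernoulli w).real (openConn v x : Set (BondConfig V))
          + (prodBernoulli w).real (openConn a v : Set (BondConfig V)) * (prodBernoulli w).real (openConn u x : Set (BondConfig V))
          + (prodBernoulli w).real (openConn a x : Set (BondConfig V)) * (prodBernoulli w).real (openConn u v : Set (BondConfig V)))) ≤ 0 := by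
    refine Finset.sum_nonpos fun u _ => Finset.sum_nonpos fun v _ => Finset.sum_nonpos fun x _ => ?_
    have h := treeFourPoint_all w a u v x
    exact mul_nonpos_of_nonneg_of_nonpos (mul_nonneg (mul_nonneg (hℓ u) (hℓ v)) (hℓ x)) (by linarith)
  -- the two asymmetric families of terms are reindexings of the first one
  have hM2 := sum3_swap12 ℓ (fun u v x =>
    (prodBernoulli w).real (openConn a u ∩ (openConn a v)ᶜ ∩ openConn v x : Set (BondConfig V)))
  have hM3 := sum3_cycle ℓ (fun u v x =>
    (prodBernoulli w).real (openConn a u ∩ (openConn a v)ᶜ ∩ openConn v x : Set (BondConfig V)))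
  have hR2 := sum3_swap12 ℓ (fun u v x =>
    (prodBernoulli w).real (openConn a u : Set (BondConfig V)) * (prodBernoulli w).real (openConn v x : Set (BondConfig V)))
  have hR3 := sum3_cycle ℓ (fun u v x =>
    (prodBernoulli w).real (openConn a u : Set (BondConfig V)) * (prodBernoulli w).real (openConn v x : Set (BondConfig V)))
  -- `openConn x u = openConn u x` needed for the cyclic reindexing of the last family
  have hsymm : ∀ y z : V, (openConn y z : Set (BondConfig V)) = openConn z y := fun y z => by
    ext ω; exact ⟨fun h => SimpleGraph.Reachable.symm h, fun h => SimpleGraph.Reachable.symm h⟩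
  -- split the symmetric sum into its seven families and recombine
  have e : ∀ u v x : V,
      ℓ u * ℓ v * ℓ x *
        ((prodBernoulli w).real (openConn a u ∩ openConn a v ∩ openConn a x : Set (BondConfig V))
          + 3 * (prodBernoulli w).real (openConn a u ∩ (openConn a v)ᶜ ∩ openConn v x : Set (BondConfig V))
          + 2 * (prodBernoulli w).real (openConn a u : Set (BondConfig V)) * (prodBernoulli w).real (openConn a v : Set (BondConfig V))
              * (prodBernoulli w).real (openConn a x : Set (BondConfig V))
          - 3 * ((prodBernoulli w).real (openConn a u : Set (BondConfig V))
              * (prodBernoulli w).real (openConn v x : Set (BondConfig V)))) =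
      ℓ u * ℓ v * ℓ x *
        ((prodBernoulli w).real (openConn a u ∩ openConn a v ∩ openConn a x : Set (BondConfig V))
          + (prodBernoulli w).real (openConn a u ∩ (openConn a v)ᶜ ∩ openConn v x : Set (BondConfig V))
          + (prodBernoulli w).real (openConn a v ∩ (openConn a u)ᶜ ∩ openConn u x : Set (BondConfig V))
          + (prodBernoulli w).real (openConn a x ∩ (openConn a u)ᶜ ∩ openConn u v : Set (BondConfig V))
          + 2 * (prodBernoulli w).real (openConn a u : Set (BondConfig V)) * (prodBernoulli w).real (openConn a v : Set (BondConfig V))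
            * (prodBernoulli w).real (openConn a x : Set (BondConfig V))
          - ((prodBernoulli w).real (openConn a u : Set (BondConfig V)) * (prodBernoulli w).real (openConn v x : Set (BondConfig V))
            + (prodBernoulli w).real (openConn a v : Set (BondConfig V)) * (prodBernoulli w).real (openConn u x : Set (BondConfig V))
            + (prodBernoulli w).real (openConn a x : Set (BondConfig V)) * (prodBernoulli w).real (openConn u v : Set (BondConfig V))))
      + (2 * (ℓ u * ℓ v * ℓ x * (prodBernoulli w).real (openConn a u ∩ (openConn a v)ᶜ ∩ openConn v x : Set (BondConfig V)))
          - ℓ u * ℓ v * ℓ x * (prodBernoulli w).real (openConn a v ∩ (openConn a u)ᶜ ∩ openConn u x : Set (BondConfig V))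
          - ℓ u * ℓ v * ℓ x * (prodBernoulli w).real (openConn a x ∩ (openConn a u)ᶜ ∩ openConn u v : Set (BondConfig V)))
      - (2 * (ℓ u * ℓ v * ℓ x * ((prodBernoulli w).real (openConn a u : Set (BondConfig V))
            * (prodBernoulli w).real (openConn v x : Set (BondConfig V))))
          - ℓ u * ℓ v * ℓ x * ((prodBernoulli w).real (openConn a v : Set (BondConfig V))
            * (prodBernoulli w).real (openConn u x : Set (BondConfig V)))
          - ℓ u * ℓ v * ℓ x * ((prodBernoulli w).real (openConn a x : Set (BondConfig V))
            * (prodBernoulli w).real (openConn u v : Set (BondConfig V)))) := by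
    intro u v x; ring
  rw [Finset.sum_congr rfl fun u (_ : u ∈ Finset.univ) => Finset.sum_congr rfl fun v (_ : v ∈ Finset.univ) =>
    Finset.sum_congr rfl fun x (_ : x ∈ Finset.univ) => e u v x]
  simp only [Finset.sum_add_distrib, Finset.sum_sub_distrib, ← Finset.mul_sum]
  -- the reindexed families
  have hM3' : ∑ u, ∑ v, ∑ x, ℓ u * ℓ v * ℓ x *
      (prodBernoulli w).real (openConn a x ∩ (openConn a u)ᶜ ∩ openConn u v : Set (BondConfig V)) =
      ∑ u, ∑ v, ∑ x, ℓ u * ℓ v * ℓ x *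
      (prodBernoulli w).real (openConn a u ∩ (openConn a v)ᶜ ∩ openConn v x : Set (BondConfig V)) := by
    rw [← hM3]
  have hR3' : ∑ u, ∑ v, ∑ x, ℓ u * ℓ v * ℓ x *
      ((prodBernoulli w).real (openConn a x : Set (BondConfig V)) * (prodBernoulli w).real (openConn u v : Set (BondConfig V))) =
      ∑ u, ∑ v, ∑ x, ℓ u * ℓ v * ℓ x *
      ((prodBernoulli w).real (openConn a u : Set (BondConfig V)) * (prodBernoulli w).real (openConn v x : Set (BondConfig V))) := by
    rw [← hR3]
  rw [hM2, hM3', hR2, hR3']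
  linarith

end Loads

/-! ### The covariance form: `3·Cov(L, S₂) ≤ 2·(E L³ − (E L)³)` -/

section Integral

variable [Fintype V]

/-- `E[Σ_u ℓ_u 1[a↔u]] = Σ_u ℓ_u P(a↔u)`. [folklore] -/
theorem integral_load (w : Sym2 V → unitInterval) (a : V) (ℓ : V → ℝ) :
    ∫ ω, ∑ u, ℓ u * (openConn a u : Set (BondConfig V)).indicator 1 ω ∂(prodBernoulli w) =
      ∑ u, ℓ u * (prodBernoulli w).real (openConn a u : Set (BondConfig V)) := by
  rw [integral_finsetSum _ (fun u _ => Integrable.of_finite)]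
  refine Finset.sum_congr rfl fun u _ => ?_
  rw [integral_const_mul, integral_indicator_one MeasurableSet.of_discrete]

/-- `E[S₂] = Σ_{v,x} ℓ_v ℓ_x P(v↔x)` for `S₂ = Σ_{v,x} ℓ_v ℓ_x 1[v↔x]` (`= Σ_K ℓ(K)²`). [folklore] -/
theorem integral_S2 (w : Sym2 V → unitInterval) (ℓ : V → ℝ) :
    ∫ ω, ∑ v, ∑ x, ℓ v * ℓ x * (openConn v x : Set (BondConfig V)).indicator 1 ω ∂(prodBernoulli w) =
      ∑ v, ∑ x, ℓ v * ℓ x * (prodBernoulli w).real (openConn v x : Set (BondConfig V)) := by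
  rw [integral_finsetSum _ (fun v _ => Integrable.of_finite)]
  refine Finset.sum_congr rfl fun v _ => ?_
  rw [integral_finsetSum _ (fun x _ => Integrable.of_finite)]
  refine Finset.sum_congr rfl fun x _ => ?_
  rw [integral_const_mul, integral_indicator_one MeasurableSet.of_discrete]

omit [Fintype V] in
/-- Product of two indicator values. [folklore] -/
theorem indicator_one_mul_indicator_one (s t : Set (BondConfig V)) (ω : BondConfig V) :
    s.indicator (1 : BondConfig V → ℝ) ω * t.indicator 1 ω = (s ∩ t).indicator 1 ω := by
  rw [Set.inter_indicator_one]; rfl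

/-- `E[L·S₂] = Σ_{u,v,x} ℓ_u ℓ_v ℓ_x P(a↔u, v↔x)`. [folklore] -/
theorem integral_load_mul_S2 (w : Sym2 V → unitInterval) (a : V) (ℓ : V → ℝ) :
    ∫ ω, (∑ u, ℓ u * (openConn a u : Set (BondConfig V)).indicator 1 ω)
        * (∑ v, ∑ x, ℓ v * ℓ x * (openConn v x : Set (BondConfig V)).indicator 1 ω) ∂(prodBernoulli w) =
      ∑ u, ∑ v, ∑ x, ℓ u * ℓ v * ℓ x * (prodBernoulli w).real (openConn a u ∩ openConn v x : Set (BondConfig V)) := by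
  have hpt : ∀ ω : BondConfig V, (∑ u, ℓ u * (openConn a u : Set (BondConfig V)).indicator 1 ω)
        * (∑ v, ∑ x, ℓ v * ℓ x * (openConn v x : Set (BondConfig V)).indicator 1 ω) =
      ∑ u, ∑ v, ∑ x, ℓ u * ℓ v * ℓ x * (openConn a u ∩ openConn v x : Set (BondConfig V)).indicator 1 ω := by
    intro ω
    rw [Finset.sum_mul_sum]
    refine Finset.sum_congr rfl fun u _ => Finset.sum_congr rfl fun v _ => ?_
    rw [Finset.mul_sum]
    refine Finset.sum_congr rfl fun x _ => ?_
    rw [← indicator_one_mul_indicator_one]; ring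
  rw [integral_congr_ae (ae_of_all _ hpt)]
  rw [integral_finsetSum _ (fun u _ => Integrable.of_finite)]
  refine Finset.sum_congr rfl fun u _ => ?_
  rw [integral_finsetSum _ (fun v _ => Integrable.of_finite)]
  refine Finset.sum_congr rfl fun v _ => ?_
  rw [integral_finsetSum _ (fun x _ => Integrable.of_finite)]
  refine Finset.sum_congr rfl fun x _ => ?_
  rw [integral_const_mul, integral_indicator_one MeasurableSet.of_discrete]

/-- `E[L³] = Σ_{u,v,x} ℓ_u ℓ_v ℓ_x P(a↔u, a↔v, a↔x)`. [folklore] -/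
theorem integral_load_cube (w : Sym2 V → unitInterval) (a : V) (ℓ : V → ℝ) :
    ∫ ω, (∑ u, ℓ u * (openConn a u : Set (BondConfig V)).indicator 1 ω) ^ 3 ∂(prodBernoulli w) =
      ∑ u, ∑ v, ∑ x, ℓ u * ℓ v * ℓ x *
        (prodBernoulli w).real (openConn a u ∩ openConn a v ∩ openConn a x : Set (BondConfig V)) := by
  have hpt : ∀ ω : BondConfig V, (∑ u, ℓ u * (openConn a u : Set (BondConfig V)).indicator 1 ω) ^ 3 =
      ∑ u, ∑ v, ∑ x, ℓ u * ℓ v * ℓ x * (openConn a u ∩ openConn a v ∩ openConn a x : Set (BondConfig V)).indicator 1 ω := by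
    intro ω
    rw [show (∑ u, ℓ u * (openConn a u : Set (BondConfig V)).indicator 1 ω) ^ 3 =
      ((∑ u, ℓ u * (openConn a u : Set (BondConfig V)).indicator 1 ω) * (∑ u, ℓ u * (openConn a u : Set (BondConfig V)).indicator 1 ω))
        * (∑ u, ℓ u * (openConn a u : Set (BondConfig V)).indicator 1 ω) by ring]
    rw [Finset.sum_mul_sum, Finset.sum_mul]
    refine Finset.sum_congr rfl fun u _ => ?_
    rw [Finset.sum_mul]
    refine Finset.sum_congr rfl fun v _ => ?_
    rw [Finset.mul_sum]
    refine Finset.sum_congr rfl fun x _ => ?_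
    rw [← indicator_one_mul_indicator_one, ← indicator_one_mul_indicator_one]; ring
  rw [integral_congr_ae (ae_of_all _ hpt)]
  rw [integral_finsetSum _ (fun u _ => Integrable.of_finite)]
  refine Finset.sum_congr rfl fun u _ => ?_
  rw [integral_finsetSum _ (fun v _ => Integrable.of_finite)]
  refine Finset.sum_congr rfl fun v _ => ?_
  rw [integral_finsetSum _ (fun x _ => Integrable.of_finite)]
  refine Finset.sum_congr rfl fun x _ => ?_
  rw [integral_const_mul, integral_indicator_one MeasurableSet.of_discrete]

/-- `P(a↔u, v↔x) = P(a↔u, a↔v, a↔x) + P(a↔u, a↮v, v↔x)`. [folklore] -/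
theorem real_conn_inter_conn_split (w : Sym2 V → unitInterval) (a u v x : V) :
    (prodBernoulli w).real (openConn a u ∩ openConn v x : Set (BondConfig V)) =
      (prodBernoulli w).real (openConn a u ∩ openConn a v ∩ openConn a x : Set (BondConfig V))
        + (prodBernoulli w).real (openConn a u ∩ (openConn a v)ᶜ ∩ openConn v x : Set (BondConfig V)) := by
  have h := ClusterCovTransfer.real_eq_inter_add_inter_compl w (openConn a u ∩ openConn v x : Set (BondConfig V))
    (openConn a v : Set (BondConfig V))
  have e1 : (openConn a u ∩ openConn v x : Set (BondConfig V)) ∩ (openConn a v : Set (BondConfig V)) =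
      (openConn a u ∩ openConn a v ∩ openConn a x : Set (BondConfig V)) := by
    ext ω
    simp only [mem_inter_iff]
    constructor
    · rintro ⟨⟨hau, hvx⟩, hav⟩; exact ⟨⟨hau, hav⟩, SimpleGraph.Reachable.trans hav hvx⟩
    · rintro ⟨⟨hau, hav⟩, hax⟩; exact ⟨⟨hau, SimpleGraph.Reachable.trans (SimpleGraph.Reachable.symm hav) hax⟩, hav⟩
  have e2 : (openConn a u ∩ openConn v x : Set (BondConfig V)) ∩ (openConn a v : Set (BondConfig V))ᶜ =
      (openConn a u ∩ (openConn a v)ᶜ ∩ openConn v x : Set (BondConfig V)) := by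
    ext ω; simp only [mem_inter_iff, mem_compl_iff]; tauto
  rw [e1, e2] at h
  exact h

/-- **THE CLUSTER-LOAD FLUCTUATION INEQUALITY (gen 39's (P)/(5)) for every finite weighted graph, every root `a` and all loads
`ℓ ≥ 0`**: with `L = Σ_u ℓ_u 1[a↔u]` (the load of the cluster of `a`) and `S₂ = Σ_{v,x} ℓ_v ℓ_x 1[v↔x]` (`= Σ_K ℓ(K)²` over the open
clusters),  `3·(E[L·S₂] − E[L]·E[S₂]) ≤ 2·(E[L³] − E[L]³)`, i.e. `3·Cov(L,S₂) ≤ 2·(EL³ − (EL)³)`, i.e. `κ₃(L) + 3·Cov(L, S₂ − L²) ≤ 0`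
(unit loads: `3·Cov(|C_a|, Σ_K|K|²) ≤ 2·(E|C_a|³ − (E|C_a|)³)`). [this work] -/
theorem cov_load_S2_le (w : Sym2 V → unitInterval) (a : V) (ℓ : V → ℝ) (hℓ : ∀ y, 0 ≤ ℓ y) :
    3 * ((∫ ω, (∑ u, ℓ u * (openConn a u : Set (BondConfig V)).indicator 1 ω)
              * (∑ v, ∑ x, ℓ v * ℓ x * (openConn v x : Set (BondConfig V)).indicator 1 ω) ∂(prodBernoulli w))
          - (∫ ω, ∑ u, ℓ u * (openConn a u : Set (BondConfig V)).indicator 1 ω ∂(prodBernoulli w))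
            * (∫ ω, ∑ v, ∑ x, ℓ v * ℓ x * (openConn v x : Set (BondConfig V)).indicator 1 ω ∂(prodBernoulli w))) ≤
      2 * ((∫ ω, (∑ u, ℓ u * (openConn a u : Set (BondConfig V)).indicator 1 ω) ^ 3 ∂(prodBernoulli w))
          - (∫ ω, ∑ u, ℓ u * (openConn a u : Set (BondConfig V)).indicator 1 ω ∂(prodBernoulli w)) ^ 3) := by
  rw [integral_load_mul_S2, integral_load, integral_S2, integral_load_cube]
  -- expand the products of sums into triple sums
  have hprod : (∑ u, ℓ u * (prodBernoulli w).real (openConn a u : Set (BondConfig V)))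
      * (∑ v, ∑ x, ℓ v * ℓ x * (prodBernoulli w).real (openConn v x : Set (BondConfig V))) =
      ∑ u, ∑ v, ∑ x, ℓ u * ℓ v * ℓ x *
        ((prodBernoulli w).real (openConn a u : Set (BondConfig V)) * (prodBernoulli w).real (openConn v x : Set (BondConfig V))) := by
    rw [Finset.sum_mul_sum]
    refine Finset.sum_congr rfl fun u _ => Finset.sum_congr rfl fun v _ => ?_
    rw [Finset.mul_sum]
    refine Finset.sum_congr rfl fun x _ => ?_
    ring
  have hcube : (∑ u, ℓ u * (prodBernoulli w).real (openConn a u : Set (BondConfig V))) ^ 3 =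
      ∑ u, ∑ v, ∑ x, ℓ u * ℓ v * ℓ x *
        ((prodBernoulli w).real (openConn a u : Set (BondConfig V)) * (prodBernoulli w).real (openConn a v : Set (BondConfig V))
          * (prodBernoulli w).real (openConn a x : Set (BondConfig V))) := by
    rw [show (∑ u, ℓ u * (prodBernoulli w).real (openConn a u : Set (BondConfig V))) ^ 3 =
      ((∑ u, ℓ u * (prodBernoulli w).real (openConn a u : Set (BondConfig V)))
        * (∑ u, ℓ u * (prodBernoulli w).real (openConn a u : Set (BondConfig V))))
        * (∑ u, ℓ u * (prodBernoulli w).real (openConn a u : Set (BondConfig V))) by ring]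
    rw [Finset.sum_mul_sum, Finset.sum_mul]
    refine Finset.sum_congr rfl fun u _ => ?_
    rw [Finset.sum_mul]
    refine Finset.sum_congr rfl fun v _ => ?_
    rw [Finset.mul_sum]
    refine Finset.sum_congr rfl fun x _ => ?_
    ring
  rw [hprod, hcube]
  simp_rw [real_conn_inter_conn_split w a]
  have key := treeFourPoint_loads w a ℓ hℓ
  -- everything is now a combination of four triple sums
  have e : ∀ u v x : V,
      ℓ u * ℓ v * ℓ x *
        ((prodBernoulli w).real (openConn a u ∩ openConn a v ∩ openConn a x : Set (BondConfig V))
          + 3 * (prodBernoulli w).real (openConn a u ∩ (openConn a v)ᶜ ∩ openConn v x : Set (BondConfig V))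
          + 2 * (prodBernoulli w).real (openConn a u : Set (BondConfig V)) * (prodBernoulli w).real (openConn a v : Set (BondConfig V))
              * (prodBernoulli w).real (openConn a x : Set (BondConfig V))
          - 3 * ((prodBernoulli w).real (openConn a u : Set (BondConfig V))
              * (prodBernoulli w).real (openConn v x : Set (BondConfig V)))) =
      3 * (ℓ u * ℓ v * ℓ x * ((prodBernoulli w).real (openConn a u ∩ openConn a v ∩ openConn a x : Set (BondConfig V))
          + (prodBernoulli w).real (openConn a u ∩ (openConn a v)ᶜ ∩ openConn v x : Set (BondConfig V))))
        - 3 * (ℓ u * ℓ v * ℓ x * ((prodBernoulli w).real (openConn a u : Set (BondConfig V))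
          * (prodBernoulli w).real (openConn v x : Set (BondConfig V))))
        - 2 * (ℓ u * ℓ v * ℓ x * (prodBernoulli w).real (openConn a u ∩ openConn a v ∩ openConn a x : Set (BondConfig V)))
        + 2 * (ℓ u * ℓ v * ℓ x * ((prodBernoulli w).real (openConn a u : Set (BondConfig V))
          * (prodBernoulli w).real (openConn a v : Set (BondConfig V)) * (prodBernoulli w).real (openConn a x : Set (BondConfig V)))) := by
    intro u v x; ring
  rw [Finset.sum_congr rfl fun u (_ : u ∈ Finset.univ) => Finset.sum_congr rfl fun v (_ : v ∈ Finset.univ) =>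
    Finset.sum_congr rfl fun x (_ : x ∈ Finset.univ) => e u v x] at key
  simp only [Finset.sum_add_distrib, Finset.sum_sub_distrib, ← Finset.mul_sum] at key
  linarith

end Integral

end APL

end Summit.CriticalPhenomena.PercolationContinuityZ3.Theorems

end
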